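import Literature.NumberTheory.EllipticCurves.TwoVariablePAdicLFunctionK
import Literature.NumberTheory.EllipticCurves.TwoVariableSelmerDual
import Literature.NumberTheory.EllipticCurves.IwasawaSelmer
import Literature.NumberTheory.EllipticCurves.ModularCurve
import Literature.NumberTheory.EllipticCurves.CongruenceNumber
import Literature.NumberTheory.EllipticCurves.Rank1Residual.Predicates
import Literature.NumberTheory.Automorphic.BCDTModularity
import HarnessLib

/-!
# Yan–Zhu 2026 (J. Algebra 693 = arXiv:2412.20078v4), §3.2 and §4 "Main conjectures over `K_∞`":
# the ORDINARY two-variable main theorem — Theorem 4.2 (1) with its (Im) clause (= statement 4.1 (1)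
# of the source), Corollary 4.6 (the `S⁻¹`-divisibility, `S ⊂ Λ_K⁺`), Corollary 2.9 (torsion) and
# Lemma 5.3 (cyclotomic descent of characteristic ideals) — with the `L`-side carrier they need:
# Hida's type-I `p`-adic Rankin–Selberg function `𝓛_p^I(f/K)` (Thm. 3.3 = [CGS, Thm. 2.2.1]) and
# Perrin-Riou's `𝓛_p^PR(E/K)` (Def. 3.4)

Source: Xiaojun Yan, Xiuwu Zhu, *Main conjectures for non-CM elliptic curves at good ordinary primes*,
J. Algebra **693** (2026) 372–402, doi:10.1016/j.jalgebra.2026.01.016 = arXiv:2412.20078. Locators are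
those of arXiv **v4** (2026-01-23, the revision carrying the journal DOI; TeX `main.tex` held at
`run/shared/lean/b2b/bsd-rank1-residual/b2b-bsdres-lit/g98/eprints/yz_v4/`, numbering table
`g98_yz_v4.numbers.txt`; v4 numbering = journal numbering): §2 setting l.439–465, Def. 2.1 l.473–480,
§2.1 Selmer groups l.482–498, Remark 2.3 l.515–517, Cor. 2.9 (`\label{impr}`) l.628–633; §3.2 l.738–792
(**Thm. 3.3** l.743–748, **Def. 3.4** l.757–763, Prop. 3.5 l.769–783); §3.3 Prop. 3.7 (`PR-MSD`)
l.821–829, Prop. 3.8 l.831–836; §4.1 setting l.909–915, **statement 4.1** (`\label{mainconj1}`)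
l.917–928, **Theorem 4.2** (`\label{mainthm1}`) l.932–949; §4.2 **Cor. 4.6** (`\label{BDP1}`)
l.996–1003 (proof l.1005–1018); §4.3 Thm. 4.7 l.1022–1034, proof of Thm. 4.2 l.1036–1056; §5.1
**Lemma 5.3** (unnumbered `lem` after Thm. 5.2) l.1086–1093. Concordance with the store text
`paper:arxiv-2412.20078` (= arXiv v2): §3.2 / §4 carry the same numbers (Thm. 3.3, Def. 3.4, Conj. 4.1,
Thm. 4.2, Cor. 4.6, Thm. 4.7: [corpus:paper:arxiv-2412.20078 p0009–p0010]); Lemma 5.3 and Cor. 5.4 are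
NEW in v4. Bib key `YanZhu2024MainConjNonCM`. Cell `pub/bsd-littype` (cross-ladder literature-typing
layer, D-0088(4)), seat `bsd-littype-04`, closing the typed gap "G1 (two-variable objects)" of
`staging/bsd-littype-04/SHEETS-04.md` for the ORDINARY side, now that the Selmer-side carriers
`WeierstrassCurve.XOrd₂ / XGr₂` (`TwoVariableSelmerDual.lean`, seat `bsd-littype-03`) are in the tree.

## The printed statements (v4, verbatim)

Setting (§2, l.440–442; §2.1 l.468; §4.1 l.909–913): "`K` an imaginary quadratic field with
discriminant `D_K`, `p > 2` a prime that splits in `K`, `p𝒪_K = 𝔭𝔭̄` … `K_∞` the `ℤ_p²`-extension of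
`K` … `Γ_K := Gal(K_∞/K)`, `Λ_K := ℤ_p[[Γ_K]]`"; "Let `E/ℚ` be an elliptic curve of conductor `N` with
`(N, D_K) = 1`. We assume that `E` has good ordinary reduction at `p`"; §4.1: "Assume that the residual
representation `ρ̄_E|_{G_K} : G_K → Aut(E[p])` is irreducible. Let `f` be the newform associated to `E`."

"**Theorem 3.3.** There exists an element `𝓛_p^I(f/K) ∈ c_f⁻¹Λ_K` such that for every finite-order
nontrivial character `ξ` of `Γ_K` of conductor `𝔭^m𝔭̄^n` with `m + n > 0`, we have
`𝓛_p^I(f/K)(ξ) = W(ξ) p^{ord_p(Nm(𝔣_ξ))/2} α_p^{-ord_p(Nm(𝔣_ξ))} (1 - p/α_p²)⁻¹ (1 - 1/α_p²)⁻¹ ·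
L(f/K, ξ⁻¹, 1)/(8π²⟨f,f⟩)`, where `α_p` is the `p`-adic unit root of `x² - a_p x + p`,
`⟨f,g⟩ = ∫_{Γ₀(N)\𝓗} \overline{f(τ)} g(τ) dτ` … and `W(ξ)` is the Artin root number." (`c_f ∈ ℤ_p`
"the congruence number associated with `f` as defined in [Hida81, §7] or [Rib83]"; "a reformulation of
[PR88, Thm. 1.1] following Hida's `p`-adic Rankin method, as given in [CGS, Thm. 2.2.1]".)

"**Definition 3.4** (Perrin-Riou's `p`-adic `L`-function). `𝓛_p^PR(E/K) := (1 - p/α_p²)(1 - 1/α_p²) ·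
deg(π_E)/c_E² · 𝓛_p^I(f_E/K) ∈ Λ_K`, where `c_E` denotes the Manin constant" (`π_E : X₀(N) → E` "a
modular parametrization", l.755).

"**4.1.** (1) `𝒳_{𝓕_ord}(E/K_∞)` is `Λ_K`-torsion and `Char_{Λ_K}(𝒳_{𝓕_ord}(E/K_∞)) = (𝓛_p^PR(E/K))`.
(2) `𝒳_{𝓕_Gr}(E/K_∞)` is `Λ_K`-torsion and `Char_{Λ_K}(𝒳_{𝓕_Gr}(E/K_∞))Λ_K^ur = (𝓛_p^Gr(E/K))`."

"**Theorem 4.2.** Suppose the residual representation `ρ̄_E|_{G_K} : G_K → Aut(E[p])` is absolutely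
irreducible. If the Heegner hypothesis holds (in particular, `sign(E/K) = −1`), then: (1)
`𝒳_{𝓕_ord}(E/K_∞)` is `Λ_K`-torsion and `Char_{Λ_K}(𝒳_{𝓕_ord}(E/K_∞)) ⊂ (𝓛_p^PR(E/K))`. (2)
`𝒳_{𝓕_Gr}(E/K_∞)` is `Λ_K`-torsion and `Char_{Λ_K}(𝒳_{𝓕_Gr}(E/K_∞))Λ_K^ur ⊂ (𝓛_p^Gr(E/K))`. Moreover, if
the following condition (Im) there exists `τ ∈ Gal(ℚ̄/ℚ(μ_{p^∞}))` such that `T_pE/(ρ_E(τ) − 1)T_pE` is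
free of rank one over `ℤ_p` holds, then [4.1] is true."

"**Corollary 4.6.** Assume that the residual representation `ρ̄_E|_{G_K}` is irreducible. There exists a
nontrivial multiplicative set `S ⊂ Λ_K⁺ ⊂ Λ_K` such that `S⁻¹Char_{Λ_K}(𝒳_{𝓕_ord}(E/K_∞)) ⊂
(𝓛_p^PR(E/K))` holds in `S⁻¹Λ_K`." (Printed proof: Hida family through `f_E`, Thm. 4.4 = [SU14, Thm. 7.7
+ Prop. 13.6 (1)] off the primes `P = P⁺𝕀_K`, Props. 3.5, 3.8, [SU14, Cor. 3.8 (ii)], Cor. 2.10,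
Cor. 2.9 — NO Beilinson–Flach input, NO Heegner hypothesis; it is the `S⁻¹`-form of the intro's
Theorem 1.6.)

"**Corollary 2.9.** `𝒳_{𝓕_ord}(E/K_∞)` is `Λ_K`-torsion, and `Char_{Λ_K}(𝒳^Σ_{𝓕_ord}(E/K_∞)) ⊃ …`"
(from Lemma 2.8: "If the residual representation `ρ̄_E|_{G_K}` is irreducible, then `𝒳^Σ_{𝓕_ord}(E/K_∞)`
is a torsion `Λ_K`-module", proved from [Kato, Thm. 17.4 (1)] for `E` and `E^K`, Lemma 2.4 and [SU14,
Prop. 3.9]; the hypothesis of Lemma 2.8 is in force).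

"**Lemma 5.3.** Let `K` be an imaginary quadratic field, and `I ⊂ Λ_K` the kernel of the natural
projection `Λ_K → Λ_K⁺`. Suppose that the residual representation `ρ̄_E|_{G_K} : G_K → Aut(E[p])` is
irreducible. Then `Char_{Λ_ℚ}(𝒳_{𝓕_ord}(E/ℚ_∞)) · Char_{Λ_ℚ}(𝒳_{𝓕_ord}(E^K/ℚ_∞)) ⊂
Char_{Λ_K}(𝒳_{𝓕_ord}(E/K_∞)) mod I` in `Λ_K⁺ ≃ Λ_ℚ`." (`E^K` the quadratic twist by `K`, Lemma 2.4;
`Γ_K⁺ = Gal(K_∞⁺/K)` identified with `Γ_ℚ = Gal(ℚ_∞/ℚ)`, l.450.)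

## Transcription (tree vocabulary only)

* `Γ_K`, `Λ_K`: a pair of `ℤ_p`-extensions `κ₁, κ₂ : Γ_K ↠ ℤ_p` with an adapted generator pair
  `(γ₁, γ₂)` (`ZpExtension.IsTopGeneratorPair`, as a `Fact` instance — the currency of `XOrd₂`); then
  `(κ₁, κ₂) : Γ_K → ℤ_p²` is onto (`TwoVariableSelmer.exists_apply_eq_of_isTopGeneratorPair`), so
  `K̃_∞ = K̄^{pairKer κ₁ κ₂}` IS the `ℤ_p²`-extension `K_∞` of the source (unique for `K` imaginary
  quadratic), `Λ_K = IwasawaAlgebra₂ p = ℤ_p⟦T₂⟧⟦T₁⟧` with `1 + T_i ↔ γ_i`. No cyclotomic/anticyclotomic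
  normalisation is needed for Thm. 4.2 (1) / Cor. 2.9: the interpolation property below is written at
  the points `(ξ(γ₁) − 1, ξ(γ₂) − 1)`, i.e. in the SAME variables as the module. For Cor. 4.6 and
  Lemma 5.3, where `Λ_K⁺ ⊂ Λ_K` and `I = ker(Λ_K → Λ_K⁺)` enter, `(κ₁, κ₂)` are THE cyclotomic and
  anticyclotomic extensions (`IsCyclotomic`, `IsAnticyclotomic`; the source's `Γ_K ≅ Γ_K⁺ × Γ_K⁻`,
  `γ₁ = γ⁺`, `γ₂ = γ⁻`), so that `Γ_K⁺ × {1} = Gal(K_∞/K_∞⁻)` is the line `κ₂ = 0` generated by `γ₁`,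
  `Λ_K⁺ = ℤ_p⟦T₁⟧ ⊂ Λ_K` (`IwasawaAlgebra₂.ofPlus = PowerSeries.map C`), `{1} × Γ_K⁻ = Gal(K_∞/K_∞⁺)` is
  generated by `γ₂`, `I = (γ⁻ − 1) = (T₂)` and `Λ_K → Λ_K/I = Λ_K⁺` is `IwasawaAlgebra₂.toPlus`.
* `𝒳_{𝓕_ord}(E/K_∞) = (W.baseChange K).XOrd₂ p κ₁ κ₂ γ₁ γ₂`, the Pontryagin dual of the classical
  Selmer group `Sel_{p^∞}(E/K̃_∞)` with its CONSTRUCTED `Λ₂`-structure (`TwoVariableSelmerDual.lean`).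
  READING (flag `YZ-2VAR-ord-is-classical`): the source's `𝒳_{𝓕_ord}` is the dual of
  `H¹_{𝓕_ord}(K, T_pE ⊗ Λ_K^∨)` (Def. 2.1: `H¹_ord = Im(H¹(F_w⁺T_pE ⊗ Λ^∨) → H¹(T_pE ⊗ Λ^∨))` at `𝔭, 𝔭̄`,
  strict at `𝔮 ∤ p`), which by Shapiro's lemma and Remark 2.3 ("the ordinary local condition `H¹_ord`
  defined here coincides with that in [SU14]") with [SU14, §3.1–3.2] / Greenberg 1999 is
  `Sel_{p^∞}(E/K_∞)^∨` at a good ordinary `p` — the identification already used by the tree for the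
  one-variable `𝒳_{𝓕_ord}(E/ℚ_∞)` (`SelmerDualData`, `YanZhu2026.thm49_…`) and `𝒳_{𝓕_ord}(E/K_∞⁻)`
  (`YanZhu2026.thm57_…`), and by `TwoVariableSelmerDual.lean` for BCS's `X^ord(E/K_∞)`. Not formalised.
* `𝓛_p^I(f/K)`: the characterising predicate `IsHidaRankinLFunction ι W κ₁ κ₂ f F` on
  `F ∈ ℚ_p⟦T⟧⟦S⟧ = CycAntiSeries p` (outer variable `↔ γ₁`, inner `↔ γ₂`; `Λ_K ↪ ℚ_p⟦T⟧⟦S⟧` is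
  `IwasawaAlgebra₂.toCycAnti = PowerSeries.map (iwasawaToPowerSeries p)`): `F` is bounded and at every
  finite-order character `ξ = pairCharacter κ₁ κ₂ n e₁ e₂` of `Γ_K` RAMIFIED AT EVERY PRIME ABOVE `p`
  (`heckeValueAt ξ v = 0` for `v ∣ p`, i.e. `m > 0` AND `n > 0`) its value at
  `(ξ(γ₁) − 1, ξ(γ₂) − 1) = (e₁(1) − 1, e₂(1) − 1)` is `i_p` of the printed right-hand side: the complex
  part `hidaRankinAlgebraicPart f ξ = W(ξ) · p^{ord_p N𝔣/2} · L(f/K, ξ⁻¹, 1)/(8π²⟨f,f⟩)` (tree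
  `artinRootNumber`, `charConductorNat`, `rankinSelbergValue f ξ⁻¹ 1`, `peterssonProduct (Gamma0 N) 2 f f`
  — the vocabulary of `IsTwoVariablePAdicLFunctionK`, Nekovář's normalisation of the SAME function;
  `8π²⟨f,f⟩ = (4π)²⟨f,f⟩_N/2`) transported by the embedding datum `ι` (`algToPadic`), times the `p`-adic
  part `hidaRankinPadicFactor W k = α^{-k}(1 - p/α²)⁻¹(1 - 1/α²)⁻¹`, `α = unitRoot W p`, `k = ord_p N𝔣_ξ`.
  READING (flag `YZ-33-range`, WEAKER than print): the source prints the formula for all `ξ ≠ 1` with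
  `m + n > 0`; we demand it only where `m > 0` and `n > 0` (there it agrees with Nekovář (0.5), whose
  `V_p(f,𝒲) = 1`, up to the units `𝒲(N)𝒲̄((√D))` and the constants `√|D|`, `(1 - p/α²)(1 - 1/α²)`),
  which still determines a bounded `F` uniquely (the remaining points are Zariski dense); at characters
  unramified at exactly one of `𝔭, 𝔭̄` the printed formula carries no `ξ`-dependent Euler factor and is
  left to the reader of [CGS, Thm. 2.2.1] (OPEN-QUESTIONS-04). "`∈ c_f⁻¹Λ_K`" is the separate clause
  `∃ G ∈ Λ_K, ι(G) = c_f · F` with `c_f = congruenceNumber f` (ARS's `r_f`, whose `p`-part is Hida's).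
* `𝓛_p^PR(E/K) = perrinRiouLFunction W π F := C(perrinRiouConstant W π) · F` for a modular
  parametrisation `π : ModularParametrizationData W N` (`π_E : X₀(N) → E`, `deg = π.modularDegree`,
  `c_E = π.maninConstant`, `f_E = π.f`): Def. 3.4 verbatim.
* "`Char ⊂ (𝓛)`" in `Λ_K`: every `g ∈ Char` is `𝓛 · h` for some `h ∈ Λ_K`, read in `ℚ_p⟦T⟧⟦S⟧` along the
  injective `toCycAnti` (`IwasawaAlgebra₂.IdealLeSpan`); "`(𝓛) ⊂ Char`": `𝓛 = ι(g)` for some `g ∈ Char`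
  (`SpanLeIdeal`); equality = both. (NOT `Ideal.map toCycAnti Char = span {𝓛}`: `p` is a unit of
  `ℚ_p⟦T⟧⟦S⟧`, which would lose the `μ`-part.) `S⁻¹Char ⊂ (𝓛)` for a nontrivial multiplicative
  `S ⊂ Λ_K⁺` ⟺ `∃ s ∈ Λ_K⁺ ∖ {0}, ∀ g ∈ Char, s·g ∈ (𝓛)` (`Λ_K` Noetherian: clear denominators of finitely
  many generators; conversely take `S = {sⁿ}`).
* "`ρ̄_E|_{G_K}` absolutely irreducible": every framing `ρ : Γ_K → GL₂(𝔽_p)` of `E[p]|_{G_K}`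
  (`(W.baseChange K).IsTorsionGaloisRep p ρ`) is `FramedRep.IsAbsolutelyIrreducible` (the binder of
  `Hsieh2014.thmB_…`); "irreducible": `(W.baseChange K).HasIrreducibleModPGaloisRep p`; (Im) = the tree's
  `Rank1Residual.BigIm W p` (verbatim the printed condition); "`p > 2` good ordinary" = `3 ≤ p ∧
  GoodOrd W p`; Heegner hypothesis = `SatisfiesHeegnerHypothesis N K` at the level `N` of `π` (= `N_E`,
  `IsNewformOf`); "`(N, D_K) = 1`" = `IsCoprime (N : ℤ) (discr K)`; "`p` splits" = two primes over `p`.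

What is NOT typed here (GAP, recorded precisely in `staging/bsd-littype-04/SHEETS-04.md` §D): part (2)
of 4.1/4.2, Thm. 4.7 (the Beilinson–Flach equivalence; cell flag `YZ26@3-BF-ERL-Ohta`) and the
MC-level Cor. 5.4 — they need `𝓛_p^Gr(E/K) = h_K · 𝓛_𝔭(K)' · 𝓛_p^II(f/K)` (Def. 3.11), and the ONE
missing carrier is Hida's type-II function `𝓛_p^II` (Thm. 3.9 = [CGS, Thm. 2.4.1] = [LLZ15, Thm. 6.1.3])
whose interpolation constant involves the Petersson norm `⟨θ_{ξ_b}, θ_{ξ_b}⟩` of a CM theta series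
(the tree has CM newforms only as the ∃-fact `Ribet1977_cmNewform_of_heckeCharacter`; the level and
measure of `⟨θ, θ⟩` are not pinned by the source's text); Katz's `𝓛_𝔭(K)` has a carrier
(`IsKatzMeasure₂`). Nothing is asserted (D-0014): four named facts, no `_holds`.

Status: REFEREED and published. Thm. 4.2's proof (§4.3) runs through Thm. 4.7 ("essentially [BSTW,
Prop. 9.18] … explicit reciprocity laws for the Beilinson–Flach classes"; at `p = 3` these rest in
print on `p ≥ 5` sources — cell documentation flag `YZ26@3-BF-ERL-Ohta`, wording in
`YanZhu2026/PPartBSD.lean`); Cor. 4.6, Cor. 2.9 and Lemma 5.3 do NOT use Thm. 4.7 (flag-free).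

## References
* X. Yan, X. Zhu, J. Algebra 693 (2026) 372–402 = arXiv:2412.20078v4 (locators above); = v2
  [corpus:paper:arxiv-2412.20078 p0009 (Thm. 3.3, Def. 3.4), p0010 (Conj. 4.1, Thm. 4.2, Cor. 4.6,
  Thm. 4.7)].
* F. Castella, G. Grossi, C. Skinner, Math. Ann. 393 (2025), Thm. 2.2.1, Prop. 2.2.4, Lemma 4.1.2.
* B. Perrin-Riou, J. London Math. Soc. (2) 38 (1988), Thm. 1.1; J. Nekovář, Math. Ann. 302 (1995)
  (0.5) — tree `IsTwoVariablePAdicLFunctionK` (same function, Nekovář's normalisation).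
* C. Skinner, E. Urban, Invent. Math. 195 (2014), §3.1–3.2, Cor. 3.8, Prop. 3.9, Thm. 7.7, Prop. 13.6.
* A. Burungale, F. Castella, C. Skinner, IMRN 2025 (arXiv:2405.00270v2) §1.4, §4.1 — tree
  `TwoVariableSelmerDual.lean` (`XOrd₂`, `XGr₂`).
-/

set_option autoImplicit false

noncomputable section

open scoped Classical

open PowerSeries NumberField IsDedekindDomain Field CongruenceSubgroup
  Literature.NumberTheory.GaloisRepresentations Literature.NumberTheory.EllipticCurves
  Literature.NumberTheory.EllipticCurves.ModularForms Literature.NumberTheory.EllipticCurves.Rank1Residual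

universe u

namespace Literature.NumberTheory.EllipticCurves

/-! ## §A. `Λ_K = ℤ_p⟦T₂⟧⟦T₁⟧` inside `ℚ_p⟦T⟧⟦S⟧`; `Λ_K⁺ ⊂ Λ_K`; divisibility of ideals by a series -/

namespace IwasawaAlgebra₂

variable (p : ℕ) [Fact p.Prime]

/-- **`Λ_K ↪ Λ_K ⊗ ℚ_p ⊂ ℚ_p⟦T⟧⟦S⟧`**: the coefficientwise embedding `ℤ_p⟦T₂⟧⟦T₁⟧ → ℚ_p⟦T⟧⟦S⟧` (outer
variable `T₁ ↦ S`, inner `T₂ ↦ T`; `PowerSeries.map` of the tree's one-variable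
`iwasawaToPowerSeries p : ℤ_p⟦T⟧ → ℚ_p⟦T⟧`). Through it an element `𝓛 ∈ Λ_K` written in the variables
`T_i = γ_i − 1` is compared with a series `F ∈ ℚ_p⟦T⟧⟦S⟧` whose values at `(ξ(γ₁) − 1, ξ(γ₂) − 1)` are
prescribed (`HasValueAt`). [cite: YanZhu2024MainConjNonCM, §2 (Λ_K = ℤ_p[[Γ_K]], arXiv:2412.20078v4 TeX l.452–457)] -/
def toCycAnti : IwasawaAlgebra₂ p →+* CycAntiSeries p :=
  PowerSeries.map (iwasawaToPowerSeries p)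

/-- `toCycAnti` is injective (coefficientwise `ℤ_p ↪ ℚ_p`; `Λ ⊂ Λ ⊗ ℚ` as bounded series).
[cite: MazurTateTeitelbaum1986Invent, §I.12] -/
theorem toCycAnti_injective : Function.Injective (toCycAnti p) :=
  PowerSeries.map_injective _ (iwasawaToPowerSeries_injective p)

/-- Coefficients of `toCycAnti`: `[T^k S^j] ι(G) = [T₂^k T₁^j] G` in `ℚ_p`.
[cite: MazurTateTeitelbaum1986Invent, §I.12] -/
@[simp] theorem coeff_coeff_toCycAnti (G : IwasawaAlgebra₂ p) (j k : ℕ) :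
    PowerSeries.coeff k (PowerSeries.coeff j (toCycAnti p G)) =
      ((PowerSeries.coeff k (PowerSeries.coeff j G) : ℤ_[p]) : ℚ_[p]) := by
  simp [toCycAnti, PowerSeries.coeff_map, iwasawaToPowerSeries]

/-- **`Λ_K⁺ = ℤ_p⟦T₁⟧ ⊂ Λ_K = ℤ_p⟦T₂⟧⟦T₁⟧`** (series constant in the inner variable `T₂`): the subring
`ℤ_p[[Γ_K⁺]]` of `ℤ_p[[Γ_K]]` along `Γ_K ≅ Γ_K⁺ × Γ_K⁻` when `γ₁` generates the line `Γ_K⁺ × {1} =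
Gal(K_∞/K_∞⁻)` ("`S ⊂ Λ_K⁺ ⊂ Λ_K`", Cor. 4.6). [cite: YanZhu2024MainConjNonCM, §2 (Λ_K^± ⊂ Λ_K, arXiv:2412.20078v4 TeX l.444–457) and Cor. 4.6 (l.996–1003)] -/
def ofPlus : IwasawaAlgebra p →+* IwasawaAlgebra₂ p :=
  PowerSeries.map (PowerSeries.C (R := ℤ_[p]))

/-- **The projection `Λ_K → Λ_K⁺` modulo `I = (γ⁻ − 1) = (T₂)`** (Lemma 5.3: "`I ⊂ Λ_K` the kernel of
the natural projection `Λ_K → Λ_K⁺`"): kill the inner variable. [cite: YanZhu2024MainConjNonCM, Lemma 5.3 (arXiv:2412.20078v4 TeX l.1086–1093)] -/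
def toPlus : IwasawaAlgebra₂ p →+* IwasawaAlgebra p :=
  PowerSeries.map (PowerSeries.constantCoeff (R := ℤ_[p]))

/-- `Λ_K⁺ → Λ_K → Λ_K⁺` is the identity (`Λ_K⁺ ⊂ Λ_K` splits the projection modulo `I`).
[cite: YanZhu2024MainConjNonCM, §2 (Λ_K^± ⊂ Λ_K, arXiv:2412.20078v4 TeX l.452–457) and Lemma 5.3 (Λ_K → Λ_K⁺, l.1086–1088)] -/
@[simp] theorem toPlus_ofPlus (g : IwasawaAlgebra p) : toPlus p (ofPlus p g) = g := by
  ext n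
  simp [toPlus, ofPlus, PowerSeries.coeff_map]

/-- `ofPlus` is injective (`Λ_K⁺ ⊂ Λ_K`). [cite: YanZhu2024MainConjNonCM, §2 (Λ_K^± ⊂ Λ_K, arXiv:2412.20078v4 TeX l.452–457)] -/
theorem ofPlus_injective : Function.Injective (ofPlus p) :=
  Function.LeftInverse.injective (toPlus_ofPlus p)

variable {p}

/-- **`J ⊂ (L)` in `Λ_K`** for an ideal `J ⊆ Λ_K` and a series `L ∈ ℚ_p⟦T⟧⟦S⟧` (meant: `L = ι(𝓛)` for some
`𝓛 ∈ Λ_K`, or `𝓛 ∈ Λ_K ⊗ ℚ_p`): every `g ∈ J` is `L · h` for some `h ∈ Λ_K`, read along `toCycAnti`.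
For `L = ι(𝓛)` this is literally `J ⊆ 𝓛Λ_K` (`toCycAnti` is an injective ring map). [cite: YanZhu2024MainConjNonCM, Thm. 4.2 (1) ("Char ⊂ (𝓛_p^PR)", arXiv:2412.20078v4 TeX l.935–938)] -/
def IdealLeSpan (J : Ideal (IwasawaAlgebra₂ p)) (L : CycAntiSeries p) : Prop :=
  ∀ g ∈ J, ∃ h : IwasawaAlgebra₂ p, toCycAnti p g = L * toCycAnti p h

/-- **`(L) ⊂ J` in `Λ_K`**: `L` is (the image of) an element of `J`. [cite: YanZhu2024MainConjNonCM, statement 4.1 (1) (equality of ideals, arXiv:2412.20078v4 TeX l.919–922)] -/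
def SpanLeIdeal (L : CycAntiSeries p) (J : Ideal (IwasawaAlgebra₂ p)) : Prop :=
  ∃ g ∈ J, toCycAnti p g = L

/-- **`S⁻¹J ⊂ (L)` in `S⁻¹Λ_K` for some nontrivial multiplicative `S ⊂ Λ_K⁺`**, in the equivalent
one-element form: some nonzero `s ∈ Λ_K⁺` multiplies `J` into `LΛ_K`. [cite: YanZhu2024MainConjNonCM, Cor. 4.6 (arXiv:2412.20078v4 TeX l.996–1003)] -/
def IdealLeSpanAwayFromPlus (J : Ideal (IwasawaAlgebra₂ p)) (L : CycAntiSeries p) : Prop :=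
  ∃ s : IwasawaAlgebra p, s ≠ 0 ∧
    ∀ g ∈ J, ∃ h : IwasawaAlgebra₂ p, toCycAnti p (ofPlus p s * g) = L * toCycAnti p h

/-- `J ⊂ (L)` implies the `S`-localised form (take `s = 1`): Thm. 4.2 (1) refines Cor. 4.6.
[cite: YanZhu2024MainConjNonCM, Thm. 4.2 (1) and Cor. 4.6 (arXiv:2412.20078v4 TeX l.935–938, l.996–1003)] -/
theorem IdealLeSpan.awayFromPlus {J : Ideal (IwasawaAlgebra₂ p)} {L : CycAntiSeries p}
    (h : IdealLeSpan J L) : IdealLeSpanAwayFromPlus J L := by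
  refine ⟨1, one_ne_zero, fun g hg ↦ ?_⟩
  obtain ⟨k, hk⟩ := h g hg
  exact ⟨k, by rw [map_one, one_mul, hk]⟩

/-- Monotonicity of `IdealLeSpan` in the ideal. [cite: YanZhu2024MainConjNonCM, Thm. 4.2 (1) ("Char ⊂ (𝓛)", arXiv:2412.20078v4 TeX l.935–938)] -/
theorem IdealLeSpan.mono {J J' : Ideal (IwasawaAlgebra₂ p)} {L : CycAntiSeries p} (hJ : J ≤ J')
    (h : IdealLeSpan J' L) : IdealLeSpan J L :=
  fun g hg ↦ h g (hJ hg)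

/-- If `J ⊂ (L)` and `(L) ⊂ J` then `J` is the principal ideal generated by the element `g` of `J` with
`ι(g) = L` — the two inclusions give the equality of ideals of statement 4.1 (1).
[cite: YanZhu2024MainConjNonCM, statement 4.1 (1) and Thm. 4.2 (Im) clause (arXiv:2412.20078v4 TeX l.917–922, l.944–948)] -/
theorem IdealLeSpan.eq_span_of_spanLeIdeal {J : Ideal (IwasawaAlgebra₂ p)} {L : CycAntiSeries p}
    (h : IdealLeSpan J L) (h' : SpanLeIdeal L J) : ∃ g ∈ J, toCycAnti p g = L ∧ J = Ideal.span {g} := by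
  obtain ⟨g, hgJ, hgL⟩ := h'
  refine ⟨g, hgJ, hgL, le_antisymm (fun x hx ↦ ?_) ((Ideal.span_singleton_le_iff_mem _).mpr hgJ)⟩
  obtain ⟨k, hk⟩ := h x hx
  rw [← hgL, ← map_mul] at hk
  rw [Ideal.mem_span_singleton']
  exact ⟨k, by rw [mul_comm]; exact (toCycAnti_injective p hk).symm⟩

end IwasawaAlgebra₂

/-! ## §B. Finite-order characters of `Γ_K` and Hida's type-I `p`-adic Rankin–Selberg function
(Yan–Zhu Thm. 3.3 = [CGS, Thm. 2.2.1]); Perrin-Riou's `𝓛_p^PR(E/K)` (Def. 3.4) -/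

section TypeOne

variable {K : Type u} [Field K] {p : ℕ} [Fact p.Prime]

/-- **The finite-order characters of `Γ_K = Gal(K_∞/K) ≅ ℤ_p²`** in the coordinates `(κ₁, κ₂)`:
`ξ(σ) = e₁(κ₁σ mod pⁿ) · e₂(κ₂σ mod pⁿ)` for additive characters `e₁, e₂` of `ℤ/pⁿ` (product of two
of the tree's `antiCycCharacter`, which is generic in the `ℤ_p`-extension despite its name). As
`n, e₁, e₂` vary these are exactly the characters of finite order of `Γ_K/pairKer κ₁ κ₂ ≅ ℤ_p²`; at an
adapted generator pair `ξ(γ₁) = e₁(1)`, `ξ(γ₂) = e₂(1)`. [cite: YanZhu2024MainConjNonCM, Thm. 3.3 ("finite-order … character ξ of Γ_K", arXiv:2412.20078v4 TeX l.744)] -/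
def pairCharacter (κ₁ κ₂ : ZpExtension K p) (n : ℕ) (e₁ e₂ : AddChar (ZMod (p ^ n)) ℂ) :
    absoluteGaloisGroup K →ₜ* ℂˣ :=
  antiCycCharacter κ₁ n e₁ * antiCycCharacter κ₂ n e₂

/-- Values of `pairCharacter`: `ξ(σ) = e₁(κ₁σ) e₂(κ₂σ)`. [cite: Nekovar1995, §3.2 (3.2.1) (finite-order characters of G(K_∞/K))] -/
theorem coe_pairCharacter_apply (κ₁ κ₂ : ZpExtension K p) (n : ℕ) (e₁ e₂ : AddChar (ZMod (p ^ n)) ℂ)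
    (σ : absoluteGaloisGroup K) :
    ((pairCharacter κ₁ κ₂ n e₁ e₂ σ : ℂˣ) : ℂ) =
      e₁ (PadicInt.toZModPow n (κ₁ σ).toAdd) * e₂ (PadicInt.toZModPow n (κ₂ σ).toAdd) := by
  rw [pairCharacter, ContinuousMonoidHom.mul_apply, Units.val_mul, coe_antiCycCharacter_apply,
    coe_antiCycCharacter_apply]

/-- At the first generator of an adapted pair, `ξ(γ₁) = e₁(1)` — the point `ξ(γ₁) − 1` at which the
outer variable is evaluated. [cite: Nekovar1995, §3.2 (3.2.1)] [cite: YanZhu2024MainConjNonCM, Thm. 3.3 (𝓛_p^I(f/K)(ξ), arXiv:2412.20078v4 TeX l.744–748)] -/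
theorem coe_pairCharacter_apply_left {κ₁ κ₂ : ZpExtension K p} {γ₁ γ₂ : absoluteGaloisGroup K}
    (h : ZpExtension.IsTopGeneratorPair κ₁ κ₂ γ₁ γ₂) (n : ℕ) (e₁ e₂ : AddChar (ZMod (p ^ n)) ℂ) :
    ((pairCharacter κ₁ κ₂ n e₁ e₂ γ₁ : ℂˣ) : ℂ) = e₁ 1 := by
  rw [coe_pairCharacter_apply, show κ₁ γ₁ = Multiplicative.ofAdd 1 from h.left, h.apply_left,
    toAdd_ofAdd, toAdd_one, map_one, map_zero, AddChar.map_zero_eq_one, mul_one]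

/-- At the second generator of an adapted pair, `ξ(γ₂) = e₂(1)` — the point `ξ(γ₂) − 1` at which the
inner variable is evaluated. [cite: Nekovar1995, §3.2 (3.2.1)] [cite: YanZhu2024MainConjNonCM, Thm. 3.3 (𝓛_p^I(f/K)(ξ), arXiv:2412.20078v4 TeX l.744–748)] -/
theorem coe_pairCharacter_apply_right {κ₁ κ₂ : ZpExtension K p} {γ₁ γ₂ : absoluteGaloisGroup K}
    (h : ZpExtension.IsTopGeneratorPair κ₁ κ₂ γ₁ γ₂) (n : ℕ) (e₁ e₂ : AddChar (ZMod (p ^ n)) ℂ) :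
    ((pairCharacter κ₁ κ₂ n e₁ e₂ γ₂ : ℂˣ) : ℂ) = e₂ 1 := by
  rw [coe_pairCharacter_apply, show κ₂ γ₂ = Multiplicative.ofAdd 1 from h.right, h.apply_right,
    toAdd_ofAdd, toAdd_one, map_one, map_zero, AddChar.map_zero_eq_one, one_mul]

variable [NumberField K] {N : ℕ} [NeZero N]

/-- **The complex (algebraic) part of Yan–Zhu's Theorem 3.3 interpolation value** at a finite-order
character `ξ` of `Γ_K`: `W(ξ) · p^{ord_p(Nm 𝔣_ξ)/2} · L(f/K, ξ⁻¹, 1) / (8π²⟨f, f⟩)` — `W(ξ)` the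
Artin root number (`artinRootNumber`), `Nm 𝔣_ξ` the conductor norm (`charConductorNat`),
`L(f/K, ξ⁻¹, 1)` the value of the Rankin–Selberg Euler product (`rankinSelbergValue f ξ⁻¹ 1`, as in
Nekovář's `L(f ⊗ K, 𝒲̄, 1)`), `⟨f, f⟩ = ∫_{Γ₀(N)\ℍ} |f|² dx dy` (`peterssonProduct (Gamma0 N) 2 f f`;
`8π²⟨f,f⟩ = (4π)²⟨f,f⟩_N/2` of `nekovarAlgebraicPart`). The unit-root factors are kept on the `p`-adic
side (`hidaRankinPadicFactor`). [cite: YanZhu2024MainConjNonCM, Thm. 3.3 (arXiv:2412.20078v4 TeX l.743–748)] -/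
def hidaRankinAlgebraicPart (f : CuspForm (Gamma0 N) 2) (χ : absoluteGaloisGroup K →ₜ* ℂˣ) : ℂ :=
  artinRootNumber χ * (Real.sqrt ((p : ℝ) ^ (charConductorNat χ).factorization p) : ℂ) *
    (rankinSelbergValue f χ⁻¹ 1 / (8 * (Real.pi : ℂ) ^ 2 * peterssonProduct (Gamma0 N) 2 f f))

/-- **The `p`-adic part of the Theorem 3.3 interpolation value** at a character of conductor norm
`p^k`: `α_p^{-k} · (1 - p/α_p²)⁻¹ · (1 - 1/α_p²)⁻¹ ∈ ℚ_p`, `α_p = unitRoot W p` "the `p`-adic unit root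
of `x² - a_p x + p`". [cite: YanZhu2024MainConjNonCM, Thm. 3.3 (arXiv:2412.20078v4 TeX l.743–748)] -/
def hidaRankinPadicFactor (W : WeierstrassCurve ℚ) [W.IsGloballyMinimal] (k : ℕ) : ℚ_[p] :=
  let u : ℚ_[p] := (unitRoot W p : ℚ_[p])
  (u⁻¹) ^ k * ((1 - (p : ℚ_[p]) / u ^ 2) * (1 - 1 / u ^ 2))⁻¹

/-- **The interpolation property of Hida's type-I `p`-adic Rankin–Selberg function `𝓛_p^I(f/K)`**
(Yan–Zhu Thm. 3.3 = [CGS, Thm. 2.2.1], "a reformulation of [PR88, Thm. 1.1] following Hida's `p`-adic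
Rankin method"): `F ∈ ℚ_p⟦T⟧⟦S⟧`, in the variables `1 + S ↔ γ₁`, `1 + T ↔ γ₂` of an adapted generator
pair of `(κ₁, κ₂)`, is bounded (`∈ Λ_K ⊗ ℚ_p`) and for every finite-order character
`ξ = pairCharacter κ₁ κ₂ n e₁ e₂` of `Γ_K` ramified at every prime of `K` above `p` (values extended by
zero vanish there, `heckeValueAt ξ v = 0`; = "conductor `𝔭^m𝔭̄^n`" with `m, n > 0` — flag `YZ-33-range`,
module docstring: the source prints `m + n > 0`) the value of `F` at `(ξ(γ₁) − 1, ξ(γ₂) − 1) =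
(e₁(1) − 1, e₂(1) − 1)` (transported to `ℂ_p` by `ι`) is
`i_p(W(ξ) p^{ord_p N𝔣/2} L(f/K, ξ⁻¹, 1)/(8π²⟨f,f⟩)) · α^{-ord_p N𝔣}(1 - p/α²)⁻¹(1 - 1/α²)⁻¹`.
A characterising PREDICATE (the printed existence "`∈ c_f⁻¹Λ_K`" is asserted only inside the named
facts below); `W` enters through `unitRoot W p`, `f` is meant to be the newform of `W`.
[cite: YanZhu2024MainConjNonCM, Thm. 3.3 (arXiv:2412.20078v4 TeX l.743–752)]
[cite: Nekovar1995, (0.5) p. 611 (the same function in Nekovář's normalisation: tree `IsTwoVariablePAdicLFunctionK`)] -/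
def IsHidaRankinLFunction (ι : integralClosure ℚ ℂ →+* ℂ_[p]) (W : WeierstrassCurve ℚ)
    [W.IsGloballyMinimal] (κ₁ κ₂ : ZpExtension K p) (f : CuspForm (Gamma0 N) 2)
    (F : CycAntiSeries p) : Prop :=
  IsBoundedCycAnti F ∧
    ∀ (n : ℕ) (e₁ e₂ : AddChar (ZMod (p ^ n)) ℂ),
      (∀ v : HeightOneSpectrum (𝓞 K), ((p : ℕ) : 𝓞 K) ∈ v.asIdeal →
        heckeValueAt (pairCharacter κ₁ κ₂ n e₁ e₂) v = 0) →
      HasValueAt F (algToPadic ι (e₁ 1) - 1) (algToPadic ι (e₂ 1) - 1)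
        (algToPadic ι (hidaRankinAlgebraicPart (p := p) f (pairCharacter κ₁ κ₂ n e₁ e₂)) *
          algebraMap ℚ_[p] ℂ_[p]
            (hidaRankinPadicFactor W ((charConductorNat (pairCharacter κ₁ κ₂ n e₁ e₂)).factorization p)))

/-- **"`𝓛_p^I(f/K) ∈ c_f⁻¹Λ_K`"** (Thm. 3.3): `c_f · F` is (the image of) an element of `Λ_K`, with
`c_f = congruenceNumber f` (Agashe–Ribet–Stein's `r_f`; its `p`-part is Hida's congruence number of
[Hida81, §7], the printed `c_f ∈ ℤ_p` up to a unit). [cite: YanZhu2024MainConjNonCM, Thm. 3.3 ("∈ c_f⁻¹Λ_K", arXiv:2412.20078v4 TeX l.740–744)] -/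
def IsCongruenceIntegral (f : CuspForm (Gamma0 N) 2) (F : CycAntiSeries p) : Prop :=
  ∃ G : IwasawaAlgebra₂ p,
    IwasawaAlgebra₂.toCycAnti p G = PowerSeries.C (PowerSeries.C (congruenceNumber f : ℚ_[p])) * F

/-- **Perrin-Riou's normalisation constant** `(1 - p/α_p²)(1 - 1/α_p²) · deg(π_E)/c_E² ∈ ℚ_p` of
Definition 3.4, for a modular parametrisation `π_E : X₀(N) → E` (`ModularParametrizationData W N`:
`deg(π_E) = π.modularDegree`, Manin constant `c_E = π.maninConstant`) and `α_p = unitRoot W p`.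
[cite: YanZhu2024MainConjNonCM, Def. 3.4 (arXiv:2412.20078v4 TeX l.757–763)] -/
def perrinRiouConstant (W : WeierstrassCurve ℚ) [W.IsGloballyMinimal]
    (π : ModularParametrizationData W N) : ℚ_[p] :=
  let u : ℚ_[p] := (unitRoot W p : ℚ_[p])
  (1 - (p : ℚ_[p]) / u ^ 2) * (1 - 1 / u ^ 2) *
    ((π.modularDegree : ℚ_[p]) / ((π.maninConstant : ℚ_[p])) ^ 2)

/-- **Perrin-Riou's `p`-adic `L`-function `𝓛_p^PR(E/K) := (1 - p/α_p²)(1 - 1/α_p²) · deg(π_E)/c_E² ·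
𝓛_p^I(f_E/K)`** (Definition 3.4), as an operation on the series `F = 𝓛_p^I(f_E/K)`.
[cite: YanZhu2024MainConjNonCM, Def. 3.4 (arXiv:2412.20078v4 TeX l.757–763)] -/
def perrinRiouLFunction (W : WeierstrassCurve ℚ) [W.IsGloballyMinimal]
    (π : ModularParametrizationData W N) (F : CycAntiSeries p) : CycAntiSeries p :=
  PowerSeries.C (PowerSeries.C (perrinRiouConstant (p := p) W π)) * F

/-- Coefficients of `𝓛_p^PR`: `[T^k S^j] 𝓛^PR = c_PR · [T^k S^j] 𝓛^I`. [cite: YanZhu2024MainConjNonCM, Def. 3.4 (arXiv:2412.20078v4 TeX l.757–763)] -/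
@[simp] theorem coeff_coeff_perrinRiouLFunction (W : WeierstrassCurve ℚ) [W.IsGloballyMinimal]
    (π : ModularParametrizationData W N) (F : CycAntiSeries p) (j k : ℕ) :
    PowerSeries.coeff k (PowerSeries.coeff j (perrinRiouLFunction (p := p) W π F)) =
      perrinRiouConstant (p := p) W π * PowerSeries.coeff k (PowerSeries.coeff j F) := by
  simp [perrinRiouLFunction, PowerSeries.coeff_C_mul]

end TypeOne

end Literature.NumberTheory.EllipticCurves

/-! ## §C. The named facts (Yan–Zhu Cor. 2.9, Thm. 4.2 (1) + (Im), Cor. 4.6, Lemma 5.3) -/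

namespace Literature.NumberTheory.EllipticCurves.YanZhu2026

open IwasawaAlgebra₂

/-- **Yan–Zhu, J. Algebra 693 (2026), Corollary 2.9, first clause (arXiv v4 l.628–633, with Lemma 2.8
l.617–622): `𝒳_{𝓕_ord}(E/K_∞)` is `Λ_K`-torsion** — at an odd good ordinary prime split in the imaginary
quadratic field `K`, `(N, D_K) = 1`, under "the residual representation `ρ̄_E|_{G_K}` is irreducible"
(the hypothesis of Lemma 2.8, from which the corollary is read off; proof: [Kato, Thm. 17.4 (1)] for `E`
and `E^K`, Lemma 2.4, [SU14, Prop. 3.9], Lemma 2.7). Transcription (module docstring): `W` a globally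
minimal model of `E/ℚ` of conductor `N`, `3 ≤ p`, `GoodOrd W p`, `IsImaginaryQuadratic K`, two primes of
`K` over `p`, `IsCoprime N D_K`, `(W.baseChange K).HasIrreducibleModPGaloisRep p`; `Γ_K` through a pair
`(κ₁, κ₂)` with adapted generators `(γ₁, γ₂)`; conclusion: the `Λ₂`-module
`(W.baseChange K).XOrd₂ p κ₁ κ₂ γ₁ γ₂ = Sel_{p^∞}(E/K̃_∞)^∨` (reading flag `YZ-2VAR-ord-is-classical`) is
torsion. Flag-free (no Beilinson–Flach input).
[cite: YanZhu2024MainConjNonCM, Cor. 2.9 (§2.1, arXiv:2412.20078v4 TeX l.628–633) with Lemma 2.8 (l.617–626) and the setting §2 l.440–442, §2.1 l.468] -/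
def cor29_XOrd₂_isTorsion : Prop :=
  ∀ {p : ℕ} [Fact p.Prime] (W : WeierstrassCurve ℚ) [W.IsElliptic] [W.IsGloballyMinimal]
    (K : Type) [Field K] [NumberField K] (κ₁ κ₂ : ZpExtension K p) (γ₁ γ₂ : absoluteGaloisGroup K)
    [Fact (ZpExtension.IsTopGeneratorPair κ₁ κ₂ γ₁ γ₂)],
    3 ≤ p → GoodOrd W p → IsImaginaryQuadratic K →
      ((Ideal.span {(p : ℤ)}).primesOver (𝓞 K)).ncard = 2 →
      IsCoprime (W.conductorNorm ℤ : ℤ) (NumberField.discr K) →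
      (W.baseChange K).HasIrreducibleModPGaloisRep p →
    Module.IsTorsion (IwasawaAlgebra₂ p) ((W.baseChange K).XOrd₂ p κ₁ κ₂ γ₁ γ₂)

/-- **Yan–Zhu, J. Algebra 693 (2026), Theorem 4.2 (1) together with its (Im) clause for part (1) of
statement 4.1 (arXiv v4 l.932–949; = arXiv v2 Thm. 4.2) — the ordinary two-variable main theorem for
`E/K` at an odd good ordinary split prime under the Heegner hypothesis.** Verbatim: "Suppose the
residual representation `ρ̄_E|_{G_K} : G_K → Aut(E[p])` is absolutely irreducible. If the Heegner
hypothesis holds …, then: (1) `𝒳_{𝓕_ord}(E/K_∞)` is `Λ_K`-torsion and `Char_{Λ_K}(𝒳_{𝓕_ord}(E/K_∞)) ⊂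
(𝓛_p^PR(E/K))`. … Moreover, if … (Im) … holds, then [4.1: `Char_{Λ_K}(𝒳_{𝓕_ord}(E/K_∞)) =
(𝓛_p^PR(E/K))`] is true." Transcription (module docstring): `W` a globally minimal model of `E/ℚ`,
`π : ModularParametrizationData W N` a modular parametrisation by `X₀(N)` (`N = N_E`, `π.f = f_E`),
`3 ≤ p`, `GoodOrd W p`, `K` imaginary quadratic with two primes over `p`, `SatisfiesHeegnerHypothesis N K`
(so `(N, D_K) = 1`), `ρ̄_E|_{G_K}` absolutely irreducible (every `𝔽_p`-framing of `E[p]|_{G_K}` is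
`FramedRep.IsAbsolutelyIrreducible`), `Γ_K` through `(κ₁, κ₂; γ₁, γ₂)`, `ι` an embedding datum;
conclusion: there is `F = 𝓛_p^I(f_E/K)` with `IsHidaRankinLFunction ι W κ₁ κ₂ π.f F` and
`IsCongruenceIntegral π.f F` (Thm. 3.3) such that, with `𝓛 = perrinRiouLFunction W π F = 𝓛_p^PR(E/K)` and
`X = (W.baseChange K).XOrd₂ p κ₁ κ₂ γ₁ γ₂`: `X` is `Λ₂`-torsion, `Char(X) ⊂ (𝓛)` (`IdealLeSpan`), and
`BigIm W p → (𝓛) ⊂ Char(X)` (`SpanLeIdeal`; with the first inclusion: equality). Part (2) (Greenberg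
side) is NOT typed (module docstring, GAP). The printed proof runs through Thm. 4.7 (cell flag
`YZ26@3-BF-ERL-Ohta` at `p = 3`); the statement is the refereed statement at every `p > 2`.
[cite: YanZhu2024MainConjNonCM, Thm. 4.2 (1) and the (Im) clause (§4.1, arXiv:2412.20078v4 TeX l.932–949), statement 4.1 (1) l.917–922, setting l.909–915, Thm. 3.3 l.743–748, Def. 3.4 l.757–763; = arXiv v2 Thm. 4.2 [corpus:paper:arxiv-2412.20078 p0010]] -/
def thm42_XOrd₂_isTorsion_charIdeal_le_perrinRiou : Prop :=
  ∀ {p : ℕ} [Fact p.Prime] (ι : integralClosure ℚ ℂ →+* ℂ_[p]) (W : WeierstrassCurve ℚ) [W.IsElliptic]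
    [W.IsGloballyMinimal] (K : Type) [Field K] [NumberField K] (κ₁ κ₂ : ZpExtension K p)
    (γ₁ γ₂ : absoluteGaloisGroup K) [Fact (ZpExtension.IsTopGeneratorPair κ₁ κ₂ γ₁ γ₂)]
    {N : ℕ} [NeZero N] (π : ModularParametrizationData W N),
    3 ≤ p → GoodOrd W p → IsImaginaryQuadratic K →
      ((Ideal.span {(p : ℤ)}).primesOver (𝓞 K)).ncard = 2 → SatisfiesHeegnerHypothesis N K →
      (∀ ρ : ModPGaloisRep K (ZMod p) 2, (W.baseChange K).IsTorsionGaloisRep p ρ →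
        FramedRep.IsAbsolutelyIrreducible ρ) →
    ∃ F : CycAntiSeries p, IsHidaRankinLFunction ι W κ₁ κ₂ π.f F ∧ IsCongruenceIntegral π.f F ∧
      Module.IsTorsion (IwasawaAlgebra₂ p) ((W.baseChange K).XOrd₂ p κ₁ κ₂ γ₁ γ₂) ∧
      IdealLeSpan (WeierstrassCurve.XOrd₂.charIdeal (W.baseChange K) p κ₁ κ₂ γ₁ γ₂)
        (perrinRiouLFunction W π F) ∧
      (BigIm W p →
        SpanLeIdeal (perrinRiouLFunction W π F)
          (WeierstrassCurve.XOrd₂.charIdeal (W.baseChange K) p κ₁ κ₂ γ₁ γ₂))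

/-- **Yan–Zhu, J. Algebra 693 (2026), Corollary 4.6 (arXiv v4 l.996–1003; = v2 Cor. 4.6) — the
`S⁻¹`-divisibility `S⁻¹Char_{Λ_K}(𝒳_{𝓕_ord}(E/K_∞)) ⊂ (𝓛_p^PR(E/K))` for a nontrivial multiplicative
`S ⊂ Λ_K⁺`, under irreducibility of `ρ̄_E|_{G_K}` ONLY** (no Heegner hypothesis, no absolute
irreducibility, no (Im); printed proof: Hida theory + [SU14, Thm. 7.7, Prop. 13.6 (1), Cor. 3.8 (ii)] off
the primes `P = P⁺Λ`, Props. 3.5/3.8, Cors. 2.9/2.10 — no Beilinson–Flach input, flag-free; it is the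
`S⁻¹`-form of the intro's Thm. 1.6). Verbatim: "Assume that the residual representation `ρ̄_E|_{G_K}`
is irreducible. There exists a nontrivial multiplicative set `S ⊂ Λ_K⁺ ⊂ Λ_K` such that
`S⁻¹Char_{Λ_K}(𝒳_{𝓕_ord}(E/K_∞)) ⊂ (𝓛_p^PR(E/K))` holds in `S⁻¹Λ_K`." Transcription (module docstring):
setting of §4.1 (+ §2.1's `(N, D_K) = 1`), `(κ₁, κ₂)` THE cyclotomic and anticyclotomic
`ℤ_p`-extensions (the source's `Γ_K ≅ Γ_K⁺ × Γ_K⁻`, `γ₁ = γ⁺`, `γ₂ = γ⁻`), so that `γ₁` generates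
`Γ_K⁺ × {1} = Gal(K_∞/K_∞⁻)` and `Λ_K⁺ = ofPlus(ℤ_p⟦T₁⟧)`; conclusion: there is `F = 𝓛_p^I(f_E/K)` (Thm. 3.3,
with `IsCongruenceIntegral`) and a nonzero `s ∈ Λ_K⁺` with `s · Char(X) ⊂ (𝓛_p^PR(E/K))`
(`IdealLeSpanAwayFromPlus`, equivalent to the printed `S⁻¹`-form since `Λ_K` is Noetherian).
[cite: YanZhu2024MainConjNonCM, Cor. 4.6 (§4.2, arXiv:2412.20078v4 TeX l.996–1018) with setting l.909–915; = arXiv v2 Cor. 4.6 [corpus:paper:arxiv-2412.20078 p0010]] -/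
def cor46_XOrd₂_charIdeal_le_perrinRiou_awayFromPlus : Prop :=
  ∀ {p : ℕ} [Fact p.Prime] (ι : integralClosure ℚ ℂ →+* ℂ_[p]) (W : WeierstrassCurve ℚ) [W.IsElliptic]
    [W.IsGloballyMinimal] (K : Type) [Field K] [NumberField K] (κ₁ κ₂ : ZpExtension K p)
    (γ₁ γ₂ : absoluteGaloisGroup K) [Fact (ZpExtension.IsTopGeneratorPair κ₁ κ₂ γ₁ γ₂)]
    {N : ℕ} [NeZero N] (π : ModularParametrizationData W N),
    3 ≤ p → GoodOrd W p → IsImaginaryQuadratic K →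
      ((Ideal.span {(p : ℤ)}).primesOver (𝓞 K)).ncard = 2 → IsCoprime (N : ℤ) (NumberField.discr K) →
      (W.baseChange K).HasIrreducibleModPGaloisRep p → κ₁.IsCyclotomic → κ₂.IsAnticyclotomic →
    ∃ F : CycAntiSeries p, IsHidaRankinLFunction ι W κ₁ κ₂ π.f F ∧ IsCongruenceIntegral π.f F ∧
      IdealLeSpanAwayFromPlus (WeierstrassCurve.XOrd₂.charIdeal (W.baseChange K) p κ₁ κ₂ γ₁ γ₂)
        (perrinRiouLFunction W π F)

/-- **Yan–Zhu, J. Algebra 693 (2026), Lemma 5.3 (arXiv v4 l.1086–1093; NEW in v4) — cyclotomic descent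
of characteristic ideals: `Char_{Λ_ℚ}(𝒳_{𝓕_ord}(E/ℚ_∞)) · Char_{Λ_ℚ}(𝒳_{𝓕_ord}(E^K/ℚ_∞)) ⊂
Char_{Λ_K}(𝒳_{𝓕_ord}(E/K_∞)) mod I` in `Λ_K⁺ ≃ Λ_ℚ`**, `I = ker(Λ_K → Λ_K⁺)`, under "the residual
representation `ρ̄_E|_{G_K}` is irreducible" (printed proof: control `𝒳(E/K_∞)/I ≅ 𝒳(E/K_∞⁺)` via
[SU14, Prop. 3.9], Lemma 2.7, Nakayama; [SU14, Cor. 3.8 (ii)]; Lemma 2.4 `𝒳(E/K_∞⁺) ≅ 𝒳(E/ℚ_∞) ⊕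
𝒳(E^K/ℚ_∞)`; flag-free). Transcription (module docstring): setting §5.1/§2 (`3 ≤ p` good ordinary,
`K` imaginary quadratic, `p` split, `(N_E, D_K) = 1`, `(W.baseChange K).HasIrreducibleModPGaloisRep p`);
`(κ₁, κ₂)` THE cyclotomic and anticyclotomic extensions of `K` (`γ₁ = γ⁺`, `γ₂ = γ⁻`, so
`I = (γ⁻ − 1) = (T₂)` and `Λ_K/I = Λ_K⁺ = ℤ_p⟦T₁⟧` via `toPlus`), `κ` THE cyclotomic `ℤ_p`-extension of
`ℚ` with generator `γ` whose action on `K_∞⁺ = Kℚ_∞` agrees with that of `γ₁`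
(`κ (absGaloisRestrict ℚ K γ₁) = κ γ = 1`: "we identify `Γ_K⁺` with `Γ_ℚ`", l.450,
`1 + T₁ ↔ γ₁ ↔ γ ↔ 1 + T`); `𝒳_{𝓕_ord}(E/ℚ_∞) = D.X`,
`𝒳_{𝓕_ord}(E^K/ℚ_∞) = D'.X` for Selmer dual data of `W` and of the quadratic twist
`W.quadraticTwist D_K` over `κ` (the tree's one-variable currency, as in `thm49_…` and
`padicLFunctionEK`); conclusion: for all `g ∈ Char(D.X)`, `g' ∈ Char(D'.X)` there is
`G ∈ Char_{Λ_K}(XOrd₂)` with `toPlus G = g · g'`.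
[cite: YanZhu2024MainConjNonCM, Lemma 5.3 (§5.1, arXiv:2412.20078v4 TeX l.1086–1147) with Lemma 2.4 (l.519–529) and §2 l.450 (Γ_K⁺ = Γ_ℚ)] -/
def lemma53_charIdeal_mul_charIdeal_le_toPlus_charIdeal : Prop :=
  ∀ {p : ℕ} [Fact p.Prime] (W : WeierstrassCurve ℚ) [W.IsElliptic] [W.IsGloballyMinimal]
    (K : Type) [Field K] [NumberField K] (κ₁ κ₂ : ZpExtension K p) (γ₁ γ₂ : absoluteGaloisGroup K)
    [Fact (ZpExtension.IsTopGeneratorPair κ₁ κ₂ γ₁ γ₂)] (κ : ZpExtension ℚ p) (γ : absoluteGaloisGroup ℚ)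
    (D : W.SelmerDualData κ γ) (D' : (W.quadraticTwist (NumberField.discr K : ℚ)).SelmerDualData κ γ),
    3 ≤ p → GoodOrd W p → IsImaginaryQuadratic K →
      ((Ideal.span {(p : ℤ)}).primesOver (𝓞 K)).ncard = 2 →
      IsCoprime (W.conductorNorm ℤ : ℤ) (NumberField.discr K) →
      (W.baseChange K).HasIrreducibleModPGaloisRep p → κ₁.IsCyclotomic → κ₂.IsAnticyclotomic →
      κ.IsCyclotomic → κ.IsTopGenerator γ → κ.IsTopGenerator (absGaloisRestrict ℚ K γ₁) →
    ∀ g ∈ D.charIdeal, ∀ g' ∈ D'.charIdeal,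
      ∃ G ∈ WeierstrassCurve.XOrd₂.charIdeal (W.baseChange K) p κ₁ κ₂ γ₁ γ₂, toPlus p G = g * g'

/-! ### Proved unfoldings -/

section API

variable {p : ℕ} [Fact p.Prime] {K : Type} [Field K] [NumberField K]

/-- Under (Im), Theorem 4.2 (1) gives statement 4.1 (1) of the source in the form "`Char(𝒳_{𝓕_ord}(E/K_∞))`
is the principal ideal of `Λ_K` generated by an element mapping to `𝓛_p^PR(E/K)`".
[cite: YanZhu2024MainConjNonCM, Thm. 4.2, (Im) clause (arXiv:2412.20078v4 TeX l.944–948)] -/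
theorem charIdeal_eq_span_of_thm42_of_bigIm (h : thm42_XOrd₂_isTorsion_charIdeal_le_perrinRiou)
    (ι : integralClosure ℚ ℂ →+* ℂ_[p]) (W : WeierstrassCurve ℚ) [W.IsElliptic] [W.IsGloballyMinimal]
    (κ₁ κ₂ : ZpExtension K p) (γ₁ γ₂ : absoluteGaloisGroup K)
    [Fact (ZpExtension.IsTopGeneratorPair κ₁ κ₂ γ₁ γ₂)] {N : ℕ} [NeZero N]
    (π : ModularParametrizationData W N) (hp : 3 ≤ p) (hord : GoodOrd W p) (hK : IsImaginaryQuadratic K)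
    (hsplit : ((Ideal.span {(p : ℤ)}).primesOver (𝓞 K)).ncard = 2) (hHeeg : SatisfiesHeegnerHypothesis N K)
    (habs : ∀ ρ : ModPGaloisRep K (ZMod p) 2, (W.baseChange K).IsTorsionGaloisRep p ρ →
      FramedRep.IsAbsolutelyIrreducible ρ) (hIm : BigIm W p) :
    ∃ (F : CycAntiSeries p) (g : IwasawaAlgebra₂ p), IsHidaRankinLFunction ι W κ₁ κ₂ π.f F ∧
      toCycAnti p g = perrinRiouLFunction W π F ∧
      WeierstrassCurve.XOrd₂.charIdeal (W.baseChange K) p κ₁ κ₂ γ₁ γ₂ = Ideal.span {g} := by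
  obtain ⟨F, hF, -, -, hle, hge⟩ := h ι W K κ₁ κ₂ γ₁ γ₂ π hp hord hK hsplit hHeeg habs
  obtain ⟨g, -, hgL, hspan⟩ := hle.eq_span_of_spanLeIdeal (hge hIm)
  exact ⟨F, g, hF, hgL, hspan⟩

/-- Theorem 4.2 (1) implies the `S`-localised divisibility of Corollary 4.6 under its own (stronger)
hypotheses (take `s = 1`). [cite: YanZhu2024MainConjNonCM, Thm. 4.2 (1) and Cor. 4.6 (arXiv:2412.20078v4 TeX l.932–938, l.996–1003)] -/
theorem idealLeSpanAwayFromPlus_of_thm42 (h : thm42_XOrd₂_isTorsion_charIdeal_le_perrinRiou)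
    (ι : integralClosure ℚ ℂ →+* ℂ_[p]) (W : WeierstrassCurve ℚ) [W.IsElliptic] [W.IsGloballyMinimal]
    (κ₁ κ₂ : ZpExtension K p) (γ₁ γ₂ : absoluteGaloisGroup K)
    [Fact (ZpExtension.IsTopGeneratorPair κ₁ κ₂ γ₁ γ₂)] {N : ℕ} [NeZero N]
    (π : ModularParametrizationData W N) (hp : 3 ≤ p) (hord : GoodOrd W p) (hK : IsImaginaryQuadratic K)
    (hsplit : ((Ideal.span {(p : ℤ)}).primesOver (𝓞 K)).ncard = 2) (hHeeg : SatisfiesHeegnerHypothesis N K)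
    (habs : ∀ ρ : ModPGaloisRep K (ZMod p) 2, (W.baseChange K).IsTorsionGaloisRep p ρ →
      FramedRep.IsAbsolutelyIrreducible ρ) :
    ∃ F : CycAntiSeries p, IsHidaRankinLFunction ι W κ₁ κ₂ π.f F ∧ IsCongruenceIntegral π.f F ∧
      IdealLeSpanAwayFromPlus (WeierstrassCurve.XOrd₂.charIdeal (W.baseChange K) p κ₁ κ₂ γ₁ γ₂)
        (perrinRiouLFunction W π F) := by
  obtain ⟨F, hF, hc, -, hle, -⟩ := h ι W K κ₁ κ₂ γ₁ γ₂ π hp hord hK hsplit hHeeg habs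
  exact ⟨F, hF, hc, hle.awayFromPlus⟩

/-- Theorem 4.2 (1) contains the torsion statement of Corollary 2.9 under its own hypotheses.
[cite: YanZhu2024MainConjNonCM, Thm. 4.2 (1) (arXiv:2412.20078v4 TeX l.935)] -/
theorem isTorsion_of_thm42 (h : thm42_XOrd₂_isTorsion_charIdeal_le_perrinRiou)
    (ι : integralClosure ℚ ℂ →+* ℂ_[p]) (W : WeierstrassCurve ℚ) [W.IsElliptic] [W.IsGloballyMinimal]
    (κ₁ κ₂ : ZpExtension K p) (γ₁ γ₂ : absoluteGaloisGroup K)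
    [Fact (ZpExtension.IsTopGeneratorPair κ₁ κ₂ γ₁ γ₂)] {N : ℕ} [NeZero N]
    (π : ModularParametrizationData W N) (hp : 3 ≤ p) (hord : GoodOrd W p) (hK : IsImaginaryQuadratic K)
    (hsplit : ((Ideal.span {(p : ℤ)}).primesOver (𝓞 K)).ncard = 2) (hHeeg : SatisfiesHeegnerHypothesis N K)
    (habs : ∀ ρ : ModPGaloisRep K (ZMod p) 2, (W.baseChange K).IsTorsionGaloisRep p ρ →
      FramedRep.IsAbsolutelyIrreducible ρ) :
    Module.IsTorsion (IwasawaAlgebra₂ p) ((W.baseChange K).XOrd₂ p κ₁ κ₂ γ₁ γ₂) := by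
  obtain ⟨-, -, -, htor, -, -⟩ := h ι W K κ₁ κ₂ γ₁ γ₂ π hp hord hK hsplit hHeeg habs
  exact htor

end API

end Literature.NumberTheory.EllipticCurves.YanZhu2026

end
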